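import Mathlib
import Summits.Ventures.PercRepro2.Defs
import Summits.Ventures.PercRepro2.Independence
import Summits.Ventures.PercRepro2.Harris
import Summits.Ventures.PercRepro2.Graph
import Summits.Ventures.PercRepro2.Exploration
import Summits.Ventures.PercRepro2.Events
import Summits.Ventures.PercRepro2.Induced
import Summits.Ventures.PercRepro2.BHK
import Summits.Ventures.PercRepro2.BHKEvents
import Summits.Ventures.PercRepro2.RBRoot

/-!
# Row 2′RB at an isolated third vertex (mine-a g5; MINE-A.md §18 «(iii) a₃ isolated»)

If every edge at the third vertex `w` has weight `0`, its cluster is `{w}` on every configuration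
of positive weight, the conditional probabilities given `C(w)` are the unconditional ones, and the
Rao–Blackwell sum equals `P(Q ∩ X) · P(Q ∩ Y) / P(Q)`: both forms of the row hold with equality
(`rbSum_isolated`, `same_isolated`, `cross_isolated`). This is the bottom of the root-edge
reduction of `RBRootEdge*`: a third vertex whose positive-weight edges all go to the roots is
reduced, edge by edge, to this case.
-/

namespace Summit.Ventures.PercRepro2

namespace RBRoot

open scoped Classical

section Isolated

variable {V : Type*} {E : Type*} [Fintype E] [DecidableEq E] [Fintype V] {R : Type*} [Field R]
  [LinearOrder R] [IsStrictOrderedRing R] (p : E → R) (ends : E → Sym2 V) (w : V)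

omit [DecidableEq E] [Fintype V] [LinearOrder R] [IsStrictOrderedRing R] in
/-- If every edge at `w` has weight `0`, every edge at `w` is closed on a configuration of
nonzero weight. -/
lemma closed_at_of_weight_ne_zero (hw : ∀ e, w ∈ ends e → p e = 0) {ω : Config E}
    (hω : weight p ω ≠ 0) {e : E} (he : w ∈ ends e) : ω e = false := by
  by_contra h
  have h' : ω e = true := by simpa using h
  apply hω
  rw [weight_eq_mul_edgeFactor p ω e, h', hw e he]
  simp [edgeFactor]

omit [DecidableEq E] [Fintype V] [LinearOrder R] [IsStrictOrderedRing R] in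
/-- If every edge at `w` has weight `0`, the cluster of `w` is `{w}` on every configuration of
nonzero weight. -/
lemma cluster_eq_singleton_of_weight_ne_zero (hw : ∀ e, w ∈ ends e → p e = 0) {ω : Config E}
    (hω : weight p ω ≠ 0) : cluster ends ω w = {w} := by
  ext u
  simp only [mem_cluster, Set.mem_singleton_iff]
  constructor
  · intro hu
    have key : u ∈ ({w} : Set V) := by
      refine mem_of_conn_of_closed (ends := ends) (ω := ω) ?_ (Set.mem_singleton w) hu
      intro x hx y hxy
      rw [Set.mem_singleton_iff] at hx
      subst hx
      obtain ⟨_, e, he, hends⟩ := openGraph_adj.1 hxy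
      have hclosed := closed_at_of_weight_ne_zero p ends x hw hω
        (show x ∈ ends e by rw [hends]; exact Sym2.mem_mk_left x y)
      rw [he] at hclosed
      simp at hclosed
    exact Set.mem_singleton_iff.1 key
  · rintro rfl
    exact conn_refl _ _ _

omit [Fintype V] [LinearOrder R] [IsStrictOrderedRing R] in
/-- With every edge at `w` of weight `0`: `P(Z ∩ {C(w) = {w}}) = P(Z)`. -/
lemma prob_inter_clusterEvent_singleton (hw : ∀ e, w ∈ ends e → p e = 0) (Z : Set (Config E)) :
    prob p (Z ∩ clusterEvent ends w {w}) = prob p Z := by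
  unfold prob
  refine Finset.sum_congr rfl fun ω _ => ?_
  by_cases hω : weight p ω = 0
  · simp only [Set.indicator_apply, hω]
    split_ifs <;> rfl
  · have hC : ω ∈ clusterEvent ends w {w} := cluster_eq_singleton_of_weight_ne_zero p ends w hw hω
    by_cases hZ : ω ∈ Z
    · rw [Set.indicator_of_mem hZ, Set.indicator_of_mem (show ω ∈ Z ∩ clusterEvent ends w {w} from ⟨hZ, hC⟩)]
    · rw [Set.indicator_of_notMem hZ, Set.indicator_of_notMem fun h => hZ h.1]

omit [Fintype V] [LinearOrder R] [IsStrictOrderedRing R] in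
/-- With every edge at `w` of weight `0`: `P(Z ∩ {C(w) = A}) = 0` for `A ≠ {w}`. -/
lemma prob_inter_clusterEvent_of_ne (hw : ∀ e, w ∈ ends e → p e = 0) (Z : Set (Config E))
    {A : Set V} (hA : A ≠ {w}) : prob p (Z ∩ clusterEvent ends w A) = 0 := by
  unfold prob
  refine Finset.sum_eq_zero fun ω _ => ?_
  by_cases hω : weight p ω = 0
  · simp only [Set.indicator_apply, hω]
    split_ifs <;> rfl
  · refine Set.indicator_of_notMem (f := weight p) fun h => hA ?_
    rw [← h.2]
    exact cluster_eq_singleton_of_weight_ne_zero p ends w hw hω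

omit [LinearOrder R] [IsStrictOrderedRing R] in
/-- **The Rao–Blackwell sum at an isolated third vertex** is `P(Q ∩ X) · P(Q ∩ Y) / P(Q)`. -/
theorem rbSum_isolated (hw : ∀ e, w ∈ ends e → p e = 0) (s t : V) (X Y : Set (Config E)) :
    rbSum p ends s t w X Y =
      prob p ((connEvent ends s t)ᶜ ∩ X) * prob p ((connEvent ends s t)ᶜ ∩ Y) /
        prob p (connEvent ends s t)ᶜ := by
  unfold rbSum
  rw [Finset.sum_eq_single ({w} : Set V)]
  · rw [Set.inter_right_comm _ _ X, Set.inter_right_comm _ _ Y,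
      prob_inter_clusterEvent_singleton p ends w hw, prob_inter_clusterEvent_singleton p ends w hw,
      prob_inter_clusterEvent_singleton p ends w hw]
  · intro A _ hA
    rw [Set.inter_right_comm _ _ X, prob_inter_clusterEvent_of_ne p ends w hw _ hA, zero_mul,
      zero_div]
  · intro h
    exact absurd (Finset.mem_univ _) h

omit [IsStrictOrderedRing R] in
/-- **(RB-same) at an isolated third vertex** (with equality). -/
theorem same_isolated (hw : ∀ e, w ∈ ends e → p e = 0) (o b s t : V) :
    prob p ((connEvent ends s t)ᶜ ∩ connEvent ends b s) *
        prob p ((connEvent ends s t)ᶜ ∩ connEvent ends o s) / prob p (connEvent ends s t)ᶜ ≤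
      rbSum p ends s t w (connEvent ends b s) (connEvent ends o s) :=
  (rbSum_isolated p ends w hw s t _ _).symm.le

omit [IsStrictOrderedRing R] in
/-- **(RB-cross) at an isolated third vertex** (with equality). -/
theorem cross_isolated (hw : ∀ e, w ∈ ends e → p e = 0) (o b s t : V) :
    rbSum p ends s t w (connEvent ends b s) (connEvent ends o t) ≤
      prob p ((connEvent ends s t)ᶜ ∩ connEvent ends b s) *
        prob p ((connEvent ends s t)ᶜ ∩ connEvent ends o t) / prob p (connEvent ends s t)ᶜ :=
  (rbSum_isolated p ends w hw s t _ _).le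

end Isolated

end RBRoot

end Summit.Ventures.PercRepro2
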